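import Mathlib
import Literature.NumberTheory.Automorphic.CompletedCohomology

/-!
# Sketch — crux-ideate stmt-Langlands-15110 (TwoAdicBianchiProModularityLevel), ideator 1, round 1

First lemmas of the two idea cards, stated (and where cheap, proved) over existing declarations.

* Card `local-flatness-transplant`: the crux's conclusion `IsHeckePoint … χ_σ` is implied by a
  CHARACTERISTIC-ZERO point of the big Hecke algebra which is continuous for the product of the
  discrete topologies — the shape in which any big `R = 𝕋` theorem (Gee–Newton Prop. 62 under their
  Conjecture 60) delivers the Artin point.  `IsHeckePoint.of_algHom` (proved).
* Card `sbt-rm-type-supply`: the two pieces of finite group theory behind "projective image `A₅` at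
  `p = 2` ⇒ after an odd-order twist `σ̄` is `SL₂(𝔽₄)`-valued": squaring is bijective on a finite
  commutative group of odd order (`sq_bijective_of_odd_card`, proved — odd-order mod-2 determinants
  have unique square roots), and the exceptional isomorphism `A₅ ≃* SL₂(𝔽₄)` (stated as a `Prop`,
  `A5IsoSL2F4`; classical, not in Mathlib).
-/

set_option linter.dupNamespace false

namespace Summit.Langlands.Langlands.Cruxes.TwoAdicBianchiProModularityLevel.Ideator1

open Literature.NumberTheory.Automorphic

universe u v

section HeckePoint

variable {k : Type u} [CommRing k] {Γ 𝒢 : Type u} [Group Γ] [Group 𝒢]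
variable (ι : Γ →* 𝒢) (T : LevelTower 𝒢) (ϖ : k) {J : Type v} (δ : J → 𝒢) (χ : J → k)

/-- **A continuous `k`-point of the big Hecke algebra is a point of `Spf 𝕋(Kᵖ)`.**
If the assignment `T_{δ j} ↦ χ j` extends to a `k`-algebra homomorphism `Φ : 𝕋(Kᵖ) → k`
(a characteristic-zero point when `k = ℤ̄_p`) which is continuous for the product of the discrete
topologies modulo every `ϖ^t` (i.e. modulo `ϖ^t` it only depends on finitely many of the
`H^i(X_{K(s)}, k/ϖ^{t'})`), then `χ` is a point of `Spf 𝕋(Kᵖ)` in the sense of `IsHeckePoint`.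
This is the form in which a big `R = 𝕋` theorem hands over the Artin point. [folklore] -/
theorem IsHeckePoint.of_algHom
    (Φ : bigHeckeAlgebra k ι T ϖ δ →ₐ[k] k)
    (hcont : ∀ t : ℕ, ∃ I : Finset TowerIndex, ∀ x y : bigHeckeAlgebra k ι T ϖ δ,
      (∀ z ∈ I, x.1 z = y.1 z) → Φ x - Φ y ∈ Ideal.span {ϖ ^ t})
    (hχ : ∀ j, Φ ⟨towerHeckeFamily k ι T ϖ (δ j), towerHeckeFamily_mem_bigHeckeAlgebra k ι T ϖ δ j⟩
      = χ j) :
    IsHeckePoint ι T ϖ δ χ := by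
  intro t
  obtain ⟨I, hI⟩ := hcont t
  refine ⟨I, (Ideal.Quotient.mkₐ k (Ideal.span {ϖ ^ t})).comp Φ, ?_, ?_⟩
  · intro x y hxy
    simp only [AlgHom.comp_apply, Ideal.Quotient.mkₐ_eq_mk]
    exact (Ideal.Quotient.mk_eq_mk_iff_sub_mem _ _).mpr (hI x y hxy)
  · intro j
    simp only [AlgHom.comp_apply, Ideal.Quotient.mkₐ_eq_mk, hχ j]

end HeckePoint

section OddTwist

/-- Squaring is a bijection on a finite commutative group of odd order: odd-order characters
(e.g. `det σ̄` for a mod-2 representation, whose values are odd-order roots of unity) have unique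
square roots, so `σ̄ ⊗ ψ̄` with `ψ̄² = (det σ̄)⁻¹` is `SL₂`-valued. [folklore] -/
theorem sq_bijective_of_odd_card {G : Type*} [CommGroup G] [Finite G] (h : Odd (Nat.card G)) :
    Function.Bijective fun g : G => g ^ 2 := by
  have hc : (Nat.card G).Coprime 2 := by
    rw [Nat.coprime_two_right]
    exact h
  exact (powCoprime hc).bijective

/-- The exceptional isomorphism behind Shepherd-Barron–Taylor's mod-2 icosahedral trick:
`A₅ ≅ SL₂(𝔽₄)` (= `SL₂(𝒪_{ℚ(√5)}/2)`, `2` being inert in `ℚ(√5)`).  Stated, not proved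
(classical; not in Mathlib). [folklore] -/
def A5IsoSL2F4 : Prop :=
  Nonempty (alternatingGroup (Fin 5) ≃* Matrix.SpecialLinearGroup (Fin 2) (GaloisField 2 2))

/-- Both groups have order `60` (sanity check of the statement's plausibility, the `SL₂` side by
`Matrix.card_SL`-type counting is not attempted here). [folklore] -/
theorem card_A5 : Nat.card (alternatingGroup (Fin 5)) = 60 := by
  rw [Nat.card_eq_fintype_card]
  have h := two_mul_card_alternatingGroup (α := Fin 5)
  rw [Fintype.card_perm, Fintype.card_fin] at h
  have h5 : Nat.factorial 5 = 120 := by decide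
  omega

end OddTwist

end Summit.Langlands.Langlands.Cruxes.TwoAdicBianchiProModularityLevel.Ideator1
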